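import Summits.QuantumFields.BalabanUV.T4Continuum.Spine.NE1p.DressedSmallFieldOnCores
import Summits.QuantumFields.BalabanUV.T4Continuum.Spine.NE1p.DressedSmallFieldTorusWitness
import Summits.QuantumFields.BalabanUV.T4Continuum.Support.B13HistWitness

/-!
# T⁴ programme, spine estimate NE1′ (node O3b/H2) — WITNESS W33 «N0p §4's CORES END FIRES»: the owner's
# `attachedPart_locE_le_of_cores_pencil` (N0p `DressedSmallFieldOnCores`, p224732) APPLIED ONCE BY NAME with a LIVE (2.14)-core of
# the FORMAT of record (`B13TermParamGaussianBi.BiCore`: non-zero Cauchy weight, a read-out that READS THE TABLE through `VppCLMM`,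
# Gaussian fluctuation integral) on the periodic carrier `tsys 4 N`; (B3) met at W24's located constant; the attached part ≠ 0

Cell `pub-balaban`, sub-cell `t4`, row NE1′ formalisation crew (`t4/formal/NE1p/LEAVES.md` row W33 ∕ DAG N29zl; INTENT HOME/CLAIMS.log
l.16497, BOOKED typer R-T109 (iv) l.16560), unit `b2b-balaban-t4-ne1p-formalise-leaf-10` (gen 8).  ADDITIVE — imports N0p
`Spine/NE1p/DressedSmallFieldOnCores` (owner t4-ne1p-p1 g27), W24 `Spine/NE1p/DressedSmallFieldTorusWitness` (leaf-04; `X₀`, `eq_X₀_iff`,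
`hsmall_torus`, `hrate_torus`, `dressedConst_le_one`, `exp_locE_cube`) and row NE5's `Support/B13HistWitness` (ne5-formalise-leaf-06; `toyFrame`,
`MeasPotFrame.ofMeasPotentials`) ONLY; toy DATA `def`s + theorems; 0 `def … : Prop`, 0 cite, 0 sorry; nothing of N0p ∕ W24 ∕ row NE5 restated.

WHY.  N0p §4's END chain `termHistExpLinear_termBi` → `attachedPart_locE_le_of_cores` → `…_pencil` — (B1)'s ANALYTIC half DISCHARGED for
activities built from `BiCore`s, rows NE2∕NE3's operator letters `hm`∕`hN`∕`hq` + the room displayed — had no applier (N0p §5 fires §1 on NE5's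
`toyD`; W31 fires §3 on a non-`BiCore` family; NE5's `nullCore` has Cauchy weight `0`, act ≡ 0).  CONTENTS: §1 a measurable TABLE `liveTable`
over NE5's `toyFrame` with `V″(Y, φ) = e^{−φ²}` (by the constructor's THEOREM `VppM_ofMeasPotentials`, not `rfl`), `‖liveTable‖ ≤ 1`; §2 ONE LIVE
CORE `coreW c r : BiCore toyFrame (fun _ : Unit => 0) ℂ Unit E1` (`E1 = EuclideanSpace ℝ (Fin 1)`, NE5's convention; `volume` = the inner-product Lebesgue
measure the format integrates against): Dirac parameter mass, Cauchy weight `c`, NE5's DECLARED toy letters `N := 1`, `q := ‖v‖²`, no constraints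
(`chi ≡ 1`), polymer family `{()}`, contour weight `τ := r` ON the circle `rad := r`, field map `B () v := v 0` ⇒ `readOut p v h = r·V″(h)(0, v 0)`
(through `VppCLMM_apply`), `N₁ = r`; §3 `coreFam`, centres `ctr0 := (0, 0)`, room `1 < 2` (the letters at `(mq, bq, N₀) = (1, 0, 1)` on the operator
ball of radius `2` are discharged INLINE in §6, in the LITERAL binder shapes of N0p §4); §4 the PARAMETER MASS `∫‖w·N·(chi·e^{−q})‖ d(δ ⊗ vol) = |c|·√π`; §5 the ACTIVITY OF RECORD on `tsys 4 N`
— one term on W24's one-cube domain `X₀`, none elsewhere, `actW k s Z := Σ_{i ∈ termsW Z} termBi … (0 + s • liveTable) k` (`hact`∕`hscale` by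
`rfl`); (B3) `hL3_W` MET at `X₀` for `c := A·e^{−2r}∕√π`, `A₀ := 0`, `A₁ := A∕2`, `ϱ := 2`, `A = (e·K₀(64,8)·9·64)⁻¹` (decay factor `1`);
`hsmall_W` = W24's `hsmall_torus`; §6 **`coresEnd_fires`** — N0p's END ONCE BY NAME, conclusion LITERAL, and `coresEnd_fires_closed : … ≤ 2·K₀(64,8)`;
§7 GENUINE: `termBi_coreFam` (the term IS `c·∫ exp(s·r·e^{−(v 0)²})·e^{−‖v‖²} dv` — it READS the table), `actW_one_sub_zero` (attached part
`= c·∫ g`, `g = (e^{r e^{−(v 0)²}} − 1)·e^{−‖v‖²} > 0`), `actW_live`, **`coresEnd_live`** (the END's bounded quantity is NOT zero, via W24's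
`exp_locE_cube`), and a table-blind `r = 0` `example` (the contour letter is not idle).

HONEST FRAMING (typer R-T109 (iv) wording + rider ADOPTED).  A DECIDED TOY ([folklore]; 0 sorry; 0 citations; no `def … : Prop` — the `def`s
are toy DATA).  This file exercises N0p §4's cores END on ONE decided `BiCore` over row NE5's TOY measurable frame (`linToyCarriers`, all-ones
constants) with NE5's DECOUPLED toy letters `N := 1`, `q := ‖v‖²` — a THEOREM-backed instance of the FORMAT of record, NOT Bałaban's (2.14)
terms, NOT rows NE2∕NE3's Gaussian data, NOT the substrate's `slotsOfRecord`; `toyFrame`'s table `e^{−φ²}` and the Dirac ⊗ Lebesgue parameter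
mass are the toy's; `|c|√π` is Mathlib's Gaussian integral (`GaussianFourier.integral_rexp_neg_mul_sq_norm`), not a fluctuation covariance of
print; (B1b) indexing is BY DEFINITION of the toy activity, (B3) = GAPS G-ne9p2-5 stays UNPRINTED for Bałaban's cores, (B5) ∕ geometry-for-
Bałaban's-densities ∕ the step-link remain DISPLAYED; 0 binders instantiated on Bałaban's densities; no wall item; R-t4r2-Q2 NOT met thereby;
NE1′ ⇐ the named binders — NOT proved, NOT printed; spine PROVED 0∕9.  Rung (B)+1 on ONE finite four-torus — NOT infinite volume, NOT a mass
gap, NOT OS on ℝ⁴, NOT Clay.  HONEST DEPENDENCY: continuum YM on T⁴ ⇐ BetaPertH ∧ nine spine estimates (0/9 proved); BetaPertH ⇐ (D1) ∧ (D4) ∧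
CAP+tail; G-an2-4 gates asym, D1 and NE2/3/4.
-/

noncomputable section

namespace Summit.QuantumFields.BalabanUV.T4Continuum.NE1p.DressedSmallFieldCoresWitness

open Set Metric MeasureTheory Complex
open scoped BigOperators
open Literature.MathematicalPhysics.QuantumFieldTheory.Balaban1983to89
open Literature.MathematicalPhysics.QuantumFieldTheory.Balaban1983to89.B12TreeDecay (K₀ K₀_pos)
open Literature.MathematicalPhysics.QuantumFieldTheory.Balaban1983to89.B13Resummation (locE)
open Literature.MathematicalPhysics.QuantumFieldTheory.Balaban1983to89.TreeLengthTorus (TDom tsys torusTreeLen torusTreeLen_singleton)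
open Literature.MathematicalPhysics.QuantumFieldTheory.Balaban1983to89.TreeLengthTorusGeometry (tgeometry TTouch)
open Summit.QuantumFields.BalabanUV.T4Continuum.B13HistDatum (level136 level143)
open Summit.QuantumFields.BalabanUV.T4Continuum.B13HistMeasurable (B13HistM)
open Summit.QuantumFields.BalabanUV.T4Continuum.B13HistReadout (VppCLMM_apply)
open Summit.QuantumFields.BalabanUV.T4Continuum.B13HistWitness (toyFrame level136_toyFrame level143_toyFrame)
open Summit.QuantumFields.BalabanUV.T4Continuum.B13TermParamGaussianBi (BiCore termBi)
open Summit.QuantumFields.BalabanUV.T4Continuum.InsertionLinearClass (linToyCarriers)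
open Summit.QuantumFields.BalabanUV.T4Continuum.NE1p.DressedSmallFieldOnCores (attachedPart_locE_le_of_cores_pencil)
open Summit.QuantumFields.BalabanUV.T4Continuum.NE1p.DressedSmallFieldTorusWitness (X₀ X₀_val eq_X₀_iff hsmall_torus hrate_torus
  prefactor_pos dressedConst_le_one exp_locE_cube)
open Summit.QuantumFields.BalabanUV.T4Continuum.NE1p.DressedSmallFieldGeometry (torus_consts)
open Summit.QuantumFields.BalabanUV.T4Continuum.NE1p.DressedSmallFieldGeometryFaces (K₀_four)

/-- One real Gaussian fluctuation variable as a Euclidean space — NE5's `OutputRateOpGaussianParamWitness.E1` CONVENTION; `ℝ` would do equally: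
`Real.measureSpace := inferInstance` IS `measureSpaceOfInnerProductSpace`, so either way `volume` is the inner-product Lebesgue measure. [folklore] -/
abbrev E1 : Type := EuclideanSpace ℝ (Fin 1)

/-! ## §1 A measurable table with a POSITIVE remainder potential `V″(Y, φ) = e^{−φ²}` (toy DATA over NE5's `toyFrame`) -/

/-- The remainder potentials `V″(Y, φ) = e^{−φ²}` (toy DATA). [folklore] -/
def liveV : (Y : ℕ) → toyFrame.Arg Y → ℂ := fun _ (φ : ℝ) => (Real.exp (-(φ ^ 2)) : ℂ)
/-- The kernel entries `Q ≡ 0` (toy DATA). [folklore] -/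
def liveQ : (Y : ℕ) → toyFrame.Arg Y → toyFrame.Bond Y → toyFrame.Bond Y → ℂ := fun _ _ _ _ => 0
/-- `|e^{−φ²}| ≤ 1 ×` the (1.36) weight (all-ones toy constants). [folklore] -/
theorem liveV_bound (Y : ℕ) (φ : ℝ) : ‖liveV Y φ‖ ≤ 1 * level136 toyFrame.consts (linToyCarriers.d Y) := by
  rw [level136_toyFrame, one_mul]; show ‖((Real.exp (-(φ ^ 2)) : ℝ) : ℂ)‖ ≤ 1
  rw [Complex.norm_real, Real.norm_eq_abs, abs_of_pos (Real.exp_pos _)]; exact Real.exp_le_one_iff.2 (neg_nonpos.2 (sq_nonneg _))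
/-- `‖0‖ ≤ 1 ×` the (1.43) weight. [folklore] -/
theorem liveQ_bound (Y : ℕ) (φ : ℝ) (b b' : toyFrame.Bond Y) :
    ‖liveQ Y φ b b'‖ ≤ 1 * level143 toyFrame.consts (linToyCarriers.d Y) (toyFrame.vol Y) := by rw [level143_toyFrame, liveQ, norm_zero]; norm_num
/-- `φ ↦ e^{−φ²}` is measurable. [folklore] -/
theorem liveV_measurable (Y : ℕ) : Measurable (liveV Y) := by
  show Measurable fun φ : ℝ => ((Real.exp (-(φ ^ 2)) : ℝ) : ℂ)
  exact Complex.measurable_ofReal.comp (Real.measurable_exp.comp ((measurable_id.pow_const 2).neg))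
/-- Constants are measurable. [folklore] -/
theorem liveQ_measurable (Y : ℕ) (b b' : toyFrame.Bond Y) : Measurable fun φ => liveQ Y φ b b' := measurable_const
/-- THE LIVE TABLE (toy DATA), built by row O1-c's constructor `ofMeasPotentials` with the factor `μ = 1`. [folklore] -/
def liveTable : B13HistM toyFrame :=
  toyFrame.ofMeasPotentials liveV liveQ 1 liveV_bound liveQ_bound liveV_measurable liveQ_measurable
/-- The constructor reproduces `V″ = e^{−φ²}` — BY THEOREM (`VppM_ofMeasPotentials`), not by `rfl`. [folklore] -/
@[simp] theorem VppM_liveTable (Y : ℕ) (φ : ℝ) : toyFrame.VppM liveTable Y φ = (Real.exp (-(φ ^ 2)) : ℂ) :=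
  toyFrame.VppM_ofMeasPotentials liveV liveQ 1 liveV_bound liveQ_bound liveV_measurable liveQ_measurable Y φ
/-- The live table lies in the unit ball. [folklore] -/
theorem norm_liveTable_le : ‖liveTable‖ ≤ 1 := toyFrame.norm_ofMeasPotentials_le _ _ zero_le_one _ _ _ _

/-! ## §2 ONE LIVE (2.14)-core of the format of record (toy DATA) -/

/-- The coordinate of the one fluctuation variable. [folklore] -/
def crd (v : E1) : ℝ := v 0
/-- … is measurable (a continuous projection). [folklore] -/
theorem measurable_crd : Measurable crd := (EuclideanSpace.proj (0 : Fin 1)).continuous.measurable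
/-- **THE LIVE CORE** (toy DATA) [decided toy]: parameters `Unit` with the Dirac mass, Cauchy weight the constant `c` (`wB = |c|`), NE5's
DECLARED toy letters `N := 1`, `q(o, p, v) := ‖v‖²`, no characteristic-function constraints, polymer family `{()}` sitting at the carrier
domain `0`, contour weight `τ := r` ON the circle `rad := r`, field map `B () v := v 0`.  Not Bałaban's (2.14) data. [folklore] -/
def coreW (c r : ℝ) (hr : 0 ≤ r) : BiCore toyFrame (fun _ : Unit => (0 : ℕ)) ℂ Unit E1 where
  lam := Measure.dirac ()
  finite := by infer_instance
  w := fun _ => (c : ℂ)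
  measW := measurable_const
  wB := |c|
  norm_w_le := fun _ => by rw [Complex.norm_real, Real.norm_eq_abs]
  N := fun _ _ => 1
  q := fun _ _ v => ((‖v‖ ^ 2 : ℝ) : ℂ)
  cons := []
  nsign := 0
  D := {()}
  τ := fun _ _ => (r : ℂ)
  measτ := fun _ => measurable_const
  rad := fun _ => r
  rad_nonneg := fun _ => hr
  norm_τ_le := fun _ _ => by rw [Complex.norm_real, Real.norm_eq_abs, abs_of_nonneg hr]
  B := fun _ v => crd v
  measB := fun _ => measurable_crd
variable (c r : ℝ) (hr : 0 ≤ r)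

/-- No constraints: the potential-free factor is `1`. [folklore] -/
theorem chi_coreW (v : E1) : (coreW c r hr).chi v = 1 := by unfold BiCore.chi BiCore.chiSet; simp [coreW]
/-- **THE READ-OUT READS THE TABLE**: `readOut p v h = r·V″(h)(0, v 0)` (`readOut_apply` ∕ `VppCLMM_apply` BY NAME). [folklore] -/
theorem readOut_coreW (p : Unit) (v : E1) (h : B13HistM toyFrame) :
    (coreW c r hr).readOut p v h = (r : ℂ) * toyFrame.VppM h 0 (crd v) := by
  rw [BiCore.readOut_apply]; show ∑ Y ∈ ({()} : Finset Unit), (r : ℂ) * _ = _; rw [Finset.sum_singleton]; rfl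
/-- … along the table pencil `s • liveTable`: `readOut p v (s • liveTable) = s·(r·e^{−(v 0)²})`. [folklore] -/
theorem readOut_coreW_smul_liveTable (p : Unit) (v : E1) (s : ℂ) :
    (coreW c r hr).readOut p v (s • liveTable) = s * ((r : ℂ) * (Real.exp (-(crd v ^ 2)) : ℂ)) := by
  rw [map_smul, smul_eq_mul, readOut_coreW, VppM_liveTable]
/-- The core's letter `N₁ = r·level136 = r`. [folklore] -/
theorem N₁_coreW : (coreW c r hr).N₁ = r := by
  unfold BiCore.N₁; show ∑ Y ∈ ({()} : Finset Unit), r * level136 toyFrame.consts (linToyCarriers.d 0) = r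
  rw [Finset.sum_singleton, level136_toyFrame, mul_one]

/-! ## §3 The core family, the class centres and the operator room (the letters `hm`∕`hN`∕`hq` are discharged INLINE in §6) -/

/-- The constant core family (toy DATA): the live core at every step, term index and carrier domain. [folklore] -/
def coreFam : ∀ (_ : ℕ) (_ : Unit), ℕ → BiCore toyFrame (fun _ : Unit => (0 : ℕ)) ℂ Unit E1 := fun _ _ _ => coreW c r hr
/-- Class centres `(0, 0)` (toy DATA). [folklore] -/
def ctr0 : ℕ → (ℕ → ℝ) → linToyCarriers.BgB → ℂ × B13HistM toyFrame := fun _ _ _ => (0, 0)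
/-- `hroom`: operator room `ROp = 1 < R′ = 2`. [folklore] -/
theorem hroom0 : ∀ k : ℕ, (fun _ : ℕ => (1 : ℝ)) k < (fun _ : ℕ => (2 : ℝ)) k := fun _ => by norm_num
/-! ## §4 The parameter mass of the core: `∫‖c·1·(1·e^{−‖v‖²})‖ d(δ ⊗ vol) = |c|·√π` -/

/-- The Gaussian integral in one variable: `∫_{E1} e^{−‖v‖²} = √π` (Mathlib, `finrank = 1`). [folklore] -/
theorem gaussian_E1 : ∫ v : E1, Real.exp (-‖v‖ ^ 2) = Real.sqrt Real.pi := by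
  have h := GaussianFourier.integral_rexp_neg_mul_sq_norm (V := E1) (b := 1) one_pos
  simp only [neg_mul, one_mul, div_one, finrank_euclideanSpace, Fintype.card_fin, Nat.cast_one] at h
  rw [h, Real.sqrt_eq_rpow]
/-- The norm of the core's density: `‖c·1·(1·e^{−‖v‖²})‖ = |c|·e^{−‖v‖²}`. [folklore] -/
theorem integrand_norm (o : ℂ) (z : Unit × E1) :
    ‖(coreW c r hr).w z.1 * (coreW c r hr).N o z.1 * ((coreW c r hr).chi z.2 * cexp (-(coreW c r hr).q o z.1 z.2))‖ =
      |c| * Real.exp (-‖z.2‖ ^ 2) := by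
  rw [chi_coreW]; show ‖(c : ℂ) * 1 * (1 * cexp (-(((‖z.2‖ ^ 2 : ℝ) : ℂ))))‖ = _
  rw [mul_one, one_mul, norm_mul, Complex.norm_real, Real.norm_eq_abs, ← Complex.ofReal_neg, Complex.norm_exp_ofReal]
/-- **THE PARAMETER MASS** `∫‖w·N·(chi·e^{−q})‖ d(lam ⊗ vol) = |c|·√π` (Dirac ⊗ Lebesgue; Mathlib's Gaussian — the toy's, not a
fluctuation covariance of print). [folklore] -/
theorem paramMass_coreW (o : ℂ) :
    ∫ z, ‖(coreW c r hr).w z.1 * (coreW c r hr).N o z.1 * ((coreW c r hr).chi z.2 * cexp (-(coreW c r hr).q o z.1 z.2))‖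
        ∂((coreW c r hr).lam.prod volume) = |c| * Real.sqrt Real.pi := by
  simp_rw [integrand_norm]
  show ∫ z, |c| * Real.exp (-‖z.2‖ ^ 2) ∂((Measure.dirac ()).prod (volume : Measure E1)) = _
  rw [Measure.dirac_prod, integral_map (measurable_prodMk_left (α := Unit) (β := E1) (x := ())).aemeasurable]
  · simp only; rw [integral_const_mul, gaussian_E1]
  · exact (continuous_const.mul (Real.continuous_exp.comp ((continuous_norm.comp continuous_snd).pow 2).neg)).aestronglyMeasurable

/-! ## §5 The activity of record on the periodic carrier `tsys 4 N` (toy DATA) and its sockets -/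

section Torus
variable (N : ℕ) [NeZero N]

/-- W24's located dressed constant `A = (e·K₀(64,8)·9·64)⁻¹` (toy DATA). [folklore] -/
def Acst : ℝ := (Real.exp 1 * K₀ 64 8 * 9 * 64)⁻¹
/-- `0 < A`. [folklore] -/ theorem Acst_pos : 0 < Acst := by unfold Acst; exact inv_pos.2 prefactor_pos
/-- The Cauchy weight `c := A·e^{−2r}∕√π` (toy DATA). [folklore] -/
def cW (r : ℝ) : ℝ := Acst * Real.exp (-(2 * r)) / Real.sqrt Real.pi
/-- `0 < c`. [folklore] -/
theorem cW_pos (r : ℝ) : 0 < cW r := by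
  unfold cW; have := Acst_pos; have := Real.exp_pos (-(2 * r)); have := Real.sqrt_pos.2 Real.pi_pos; positivity
open Classical in
/-- The term indexing (toy DATA): ONE term on W24's one-cube domain `X₀`, none elsewhere. [folklore] -/
def termsW (Z : TDom 4 N) : Finset Unit := if Z.1 = {0} then {()} else ∅
/-- THE ACTIVITY OF RECORD (toy DATA): the sum of the cores' terms along the pencil `s ↦ 0 + s • liveTable` — BY DEFINITION, so N0p's
INDEXING half `hact` holds by `rfl` and `hscale` by `rfl` (`emb Z := k`). [folklore] -/
def actW (k : ℕ) (s : ℂ) (Z : TDom 4 N) : ℂ :=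
  ∑ i ∈ termsW N Z, termBi (coreFam (cW r) r hr) k i (0 : ℂ) ((0 : B13HistM toyFrame) + s • liveTable) k
/-- On `X₀` there is exactly one term. [folklore] -/
theorem termsW_X₀ : termsW N (X₀ N) = {()} := by unfold termsW; rw [if_pos (X₀_val N)]
/-- **(B3) `hL3` MET AT THE LOCATED CONSTANT** [decided toy]: a domain inside `X₀` IS `X₀` (W24 `eq_X₀_iff`), where the weighted
parameter mass `|c|√π·e^{r·(‖0‖ + 2‖liveTable‖)} = A·e^{−2r(1 − ‖liveTable‖)} ≤ A = A₀ + ϱA₁` (decay factor `1`: `d(X₀) = 0`). [folklore] -/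
theorem hL3_W (k : ℕ) (R : ℝ) :
    ∀ Z : (tsys 4 N).Dom, (tgeometry 4 N).cubes Z ⊆ (tgeometry 4 N).cubes (X₀ N) →
      ∑ i ∈ termsW N Z, (∫ z, ‖(coreFam (cW r) r hr k i k).w z.1 * (coreFam (cW r) r hr k i k).N (0 : ℂ) z.1 *
          ((coreFam (cW r) r hr k i k).chi z.2 * cexp (-(coreFam (cW r) r hr k i k).q (0 : ℂ) z.1 z.2))‖
            ∂((coreFam (cW r) r hr k i k).lam.prod volume)) *
        Real.exp ((coreFam (cW r) r hr k i k).N₁ * (‖(0 : B13HistM toyFrame)‖ + 2 * ‖liveTable‖)) ≤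
      (0 + 2 * (Acst / 2)) * Real.exp (-(R * (tsys 4 N).dj Z)) := by
  intro Z hZ
  have hZX : Z = X₀ N := (eq_X₀_iff N Z).1 ((Finset.Nonempty.subset_singleton_iff Z.2.1).1 hZ)
  subst hZX
  rw [termsW_X₀, Finset.sum_singleton]
  unfold coreFam
  rw [paramMass_coreW, N₁_coreW, norm_zero, zero_add]
  have hd : (tsys 4 N).dj (X₀ N) = 0 := by show torusTreeLen (X₀ N).1 = 0; rw [X₀_val]; exact torusTreeLen_singleton 0
  rw [hd, mul_zero, neg_zero, Real.exp_zero, mul_one, abs_of_pos (cW_pos r)]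
  have hT : ‖liveTable‖ ≤ 1 := norm_liveTable_le
  unfold cW
  rw [div_mul_cancel₀ _ (Real.sqrt_pos.2 Real.pi_pos).ne']
  calc Acst * Real.exp (-(2 * r)) * Real.exp (r * (2 * ‖liveTable‖))
      = Acst * Real.exp (-(2 * r) + r * (2 * ‖liveTable‖)) := by rw [mul_assoc, ← Real.exp_add]
    _ ≤ Acst * Real.exp 0 := by
        gcongr
        · exact Acst_pos.le
        · nlinarith
    _ = 0 + 2 * (Acst / 2) := by rw [Real.exp_zero]; ring
/-- The «ε small» clause at the located constant: W24's `hsmall_torus` BY NAME. [folklore] -/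
theorem hsmall_W : (0 + 2 * (Acst / 2)) * Real.exp (0 + 1) * (tgeometry 4 N).K₀ * (tgeometry 4 N).ν * (tgeometry 4 N).c₁ ≤ 1 := by
  rw [show (0 : ℝ) + 2 * (Acst / 2) = Acst by ring]; exact hsmall_torus N

/-! ## §6 THE END FIRES: N0p §4's cores END applied ONCE BY NAME -/

open Classical in
/-- **N0p §4's CORES END FIRES ON THE LIVE CORE** [decided toy]: `attachedPart_locE_le_of_cores_pencil (tsys 4 N) (tgeometry 4 N) coreFam`
with `hroom0` and the letters `hm`∕`hN`∕`hq` at `(mq, bq, N₀) = (1, 0, 1)` discharged INLINE (constants measurable ∕ holomorphic; margin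
`1·‖v‖² − 0 ≤ Re ‖v‖²` — NE5's `termGaussianParamBi_termBi_toy` pattern), the pencil's two radius inequalities, `hscale`∕`hact` by `rfl`, W24's
`hrate_torus`, `hsmall_W`, `hL3_W`, `hϱ : 2 ≤ 2`, `hϱA`.  Conclusion LITERAL.  Nothing of Bałaban's densities. [folklore] -/
theorem coresEnd_fires (k : ℕ) :
    ‖locE (tgeometry 4 N).ι (tgeometry 4 N).cubes (actW r hr N k 1) ((tgeometry 4 N).cubes (X₀ N)) -
        locE (tgeometry 4 N).ι (tgeometry 4 N).cubes (actW r hr N k 0) ((tgeometry 4 N).cubes (X₀ N))‖ ≤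
      4 * (Real.exp 1 * (tgeometry 4 N).ν * (tgeometry 4 N).c₁ * (tgeometry 4 N).K₀ ^ 2) * (Acst / 2) *
        Real.exp (-(0 * (tsys 4 N).dj (X₀ N))) :=
  attachedPart_locE_le_of_cores_pencil (tsys 4 N) (tgeometry 4 N) (coreFam (cW r) r hr)
    (W := Set.univ) (ctr := ctr0) (ROp := fun _ => 1) (RHist := fun _ => 2) (R' := fun _ => 2)
    (mq := fun _ _ _ => 1) (bq := fun _ _ _ => 0) (N₀ := fun _ _ _ => 1)
    hroom0 (fun _ _ _ _ _ _ _ => one_pos)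
    (fun _ _ _ _ _ _ _ => ⟨fun _ _ => aestronglyMeasurable_const, fun _ => differentiableOn_const _, fun _ _ _ => by
      show ‖(1 : ℂ)‖ ≤ 1; rw [norm_one]⟩)
    (fun _ _ _ _ _ _ _ => ⟨fun _ _ => (Complex.measurable_ofReal.comp (measurable_snd.norm.pow_const 2)).aestronglyMeasurable,
      fun _ _ => differentiableOn_const _, fun _ _ _ v => by show 1 * ‖v‖ ^ 2 - 0 ≤ (((‖v‖ ^ 2 : ℝ) : ℂ)).re; rw [Complex.ofReal_re]; simp⟩)
    (g := fun _ => 0) (Set.mem_univ _) (U := ()) (o := 0) (h₀ := 0) (w := liveTable) (ϱ := 2)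
    (by show ‖(0 : ℂ) - 0‖ ≤ 1; simp)
    (by show ‖(0 : B13HistM toyFrame) - 0‖ + 2 * ‖liveTable‖ ≤ 2; rw [sub_zero, norm_zero, zero_add];
        linarith [norm_liveTable_le])
    (emb := fun _ => k) (fun _ => rfl) (terms := termsW N) (act := actW r hr N k) (fun _ _ _ => rfl)
    (A₀ := 0) (A₁ := Acst / 2) (R := 2 * (tgeometry 4 N).κ₀ + 2) (r₁ := 0) (b₅ := 0) (X₀ := X₀ N)
    le_rfl (by have := Acst_pos; positivity) le_rfl (by norm_num) (hrate_torus N) (hsmall_W N) (hL3_W r hr N k _)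
    le_rfl (by have := Acst_pos; linarith)
open Classical in
/-- … in CLOSED FORM: `≤ 4·(e·9·64·K₀(64,8)²)·(A∕2) = 2·K₀(64,8)` (pv22's constants by `torus_consts`∕`K₀_four` BY NAME). [folklore] -/
theorem coresEnd_fires_closed (k : ℕ) :
    ‖locE (tgeometry 4 N).ι (tgeometry 4 N).cubes (actW r hr N k 1) ((tgeometry 4 N).cubes (X₀ N)) -
        locE (tgeometry 4 N).ι (tgeometry 4 N).cubes (actW r hr N k 0) ((tgeometry 4 N).cubes (X₀ N))‖ ≤ 2 * K₀ 64 8 := by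
  refine (coresEnd_fires r hr N k).trans (le_of_eq ?_)
  rw [(torus_consts N).1, (torus_consts N).2.2, K₀_four, zero_mul, neg_zero, Real.exp_zero, mul_one]
  unfold Acst
  have hK := K₀_pos (64 : ℝ) 8
  have he := Real.exp_pos 1
  field_simp
  ring

/-! ## §7 GENUINE: the term READS the table, and the attached part is NOT zero -/

/-- **THE TERM IN CLOSED FORM** [decided toy]: `termBi coreFam k () 0 (0 + s•liveTable) X = c·∫ exp(s·r·e^{−(v 0)²})·e^{−‖v‖²} dv` — the
Dirac mass integrates out, `chi = 1`, `N = 1`, and the read-out EVALUATES the table at the field's coordinate. [folklore] -/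
theorem termBi_coreFam (k : ℕ) (s : ℂ) (X : ℕ) :
    termBi (coreFam (cW r) r hr) k () (0 : ℂ) ((0 : B13HistM toyFrame) + s • liveTable) X =
      (cW r : ℂ) * ∫ v : E1, cexp (s * ((r : ℂ) * (Real.exp (-(crd v ^ 2)) : ℂ))) * cexp (-(((‖v‖ ^ 2 : ℝ) : ℂ))) := by
  unfold termBi
  show ∫ p, (coreW (cW r) r hr).w p * (coreW (cW r) r hr).N 0 p *
      ∫ v, (coreW (cW r) r hr).chi v * cexp ((coreW (cW r) r hr).readOut p v (0 + s • liveTable)) *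
        cexp (-(coreW (cW r) r hr).q 0 p v) ∂volume ∂(coreW (cW r) r hr).lam = _
  simp_rw [chi_coreW, zero_add, readOut_coreW_smul_liveTable, one_mul]
  show ∫ p, (cW r : ℂ) * 1 * ∫ v, cexp (s * ((r : ℂ) * (Real.exp (-(crd v ^ 2)) : ℂ))) *
      cexp (-(((‖v‖ ^ 2 : ℝ) : ℂ))) ∂volume ∂(Measure.dirac ()) = _
  rw [integral_dirac, mul_one]
/-- The LIVE increment density `g(v) := (e^{r·e^{−(v 0)²}} − 1)·e^{−‖v‖²}` (toy DATA). [folklore] -/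
def incr (v : E1) : ℝ := (Real.exp (r * Real.exp (-(crd v ^ 2))) - 1) * Real.exp (-‖v‖ ^ 2)
/-- `0 < g(v)` for `0 < r` (`e^t − 1 > 0` for `t > 0`). [folklore] -/
theorem incr_pos (hr0 : 0 < r) (v : E1) : 0 < incr r v := by
  refine mul_pos ?_ (Real.exp_pos _)
  have : 0 < r * Real.exp (-(crd v ^ 2)) := mul_pos hr0 (Real.exp_pos _)
  linarith [Real.add_one_lt_exp this.ne']
include hr in
/-- `0 ≤ g ≤ (e^r − 1)·e^{−‖v‖²}`. [folklore] -/
theorem incr_nonneg_le (v : E1) : 0 ≤ incr r v ∧ incr r v ≤ (Real.exp r - 1) * Real.exp (-‖v‖ ^ 2) := by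
  have h0 : 0 ≤ r * Real.exp (-(crd v ^ 2)) := mul_nonneg hr (Real.exp_pos _).le
  refine ⟨mul_nonneg (by linarith [Real.add_one_le_exp (r * Real.exp (-(crd v ^ 2)))]) (Real.exp_pos _).le,
    mul_le_mul_of_nonneg_right ?_ (Real.exp_pos _).le⟩
  gcongr
  calc r * Real.exp (-(crd v ^ 2)) ≤ r * 1 := by gcongr; exact Real.exp_le_one_iff.2 (neg_nonpos.2 (sq_nonneg _))
    _ = r := mul_one r
/-- The complex Gaussian density is integrable on `E1` (Mathlib, inner-product volume). [folklore] -/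
theorem integrable_gauss_E1_cexp : Integrable (fun v : E1 => cexp (-(((‖v‖ ^ 2 : ℝ) : ℂ)))) := by
  have h := GaussianFourier.integrable_cexp_neg_mul_sq_norm_add (V := E1) (b := 1) (by simp) 0 0
  refine h.congr (Filter.Eventually.of_forall fun v => ?_)
  simp only [neg_mul, one_mul, zero_mul, add_zero, Complex.ofReal_pow]
/-- … and so is the real one. [folklore] -/
theorem integrable_gauss_E1 : Integrable (fun v : E1 => Real.exp (-‖v‖ ^ 2)) := by
  refine (integrable_gauss_E1_cexp.norm).congr (Filter.Eventually.of_forall fun v => ?_)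
  show ‖cexp (-(((‖v‖ ^ 2 : ℝ) : ℂ)))‖ = Real.exp (-‖v‖ ^ 2)
  rw [← Complex.ofReal_neg, Complex.norm_exp_ofReal]
include hr in
/-- `g` is integrable (continuous, dominated by a Gaussian). [folklore] -/
theorem integrable_incr : Integrable (incr r) := by
  have hc : Continuous (incr r) := by unfold incr crd; fun_prop
  refine Integrable.mono' ((integrable_gauss_E1).const_mul (Real.exp r - 1)) hc.aestronglyMeasurable
    (Filter.Eventually.of_forall fun v => ?_)
  rw [Real.norm_eq_abs, abs_of_nonneg (incr_nonneg_le r hr v).1]; exact (incr_nonneg_le r hr v).2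
/-- **`0 < ∫ g`**: the support is everything and the inner-product Lebesgue measure charges open sets. [folklore] -/
theorem integral_incr_pos (hr0 : 0 < r) : 0 < ∫ v, incr r v := by
  have hsupp : Function.support (incr r) = Set.univ := Set.eq_univ_of_forall fun v => (incr_pos r hr0 v).ne'
  rw [integral_pos_iff_support_of_nonneg_ae (Filter.Eventually.of_forall fun v => (incr_pos r hr0 v).le)
    (integrable_incr r hr0.le), hsupp]
  exact isOpen_univ.measure_pos volume Set.univ_nonempty
include hr in
/-- The read-out growth along the pencil: `‖exp(s·r·e^{−(v 0)²})‖ ≤ e^{‖s‖r}`. [folklore] -/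
theorem norm_cexp_readOut_le (s : ℂ) (v : E1) : ‖cexp (s * ((r : ℂ) * (Real.exp (-(crd v ^ 2)) : ℂ)))‖ ≤ Real.exp (‖s‖ * r) := by
  rw [Complex.norm_exp]
  refine Real.exp_le_exp.2 ((Complex.re_le_norm _).trans ?_)
  rw [norm_mul, norm_mul, Complex.norm_real, Complex.norm_real, Real.norm_eq_abs, Real.norm_eq_abs, abs_of_nonneg hr,
    abs_of_pos (Real.exp_pos _)]
  calc ‖s‖ * (r * Real.exp (-(crd v ^ 2))) ≤ ‖s‖ * (r * 1) := by
        gcongr; exact Real.exp_le_one_iff.2 (neg_nonpos.2 (sq_nonneg _))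
    _ = ‖s‖ * r := by rw [mul_one]
include hr in
/-- The term's integrand is integrable (bounded read-out factor × integrable Gaussian). [folklore] -/
theorem integrable_term (s : ℂ) :
    Integrable (fun v : E1 => cexp (s * ((r : ℂ) * (Real.exp (-(crd v ^ 2)) : ℂ))) * cexp (-(((‖v‖ ^ 2 : ℝ) : ℂ)))) := by
  have hc : Continuous fun v : E1 => cexp (s * ((r : ℂ) * (Real.exp (-(crd v ^ 2)) : ℂ))) := by unfold crd; fun_prop
  exact (integrable_gauss_E1_cexp).bdd_mul hc.aestronglyMeasurable (Filter.Eventually.of_forall fun v => norm_cexp_readOut_le r hr s v)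
/-- **THE ATTACHED PART OF THE ACTIVITY AT `X₀` IN CLOSED FORM**: `act 1 X₀ − act 0 X₀ = c·∫ g` — a REAL integral times `c`. [folklore] -/
theorem actW_one_sub_zero (k : ℕ) :
    actW r hr N k 1 (X₀ N) - actW r hr N k 0 (X₀ N) = (cW r : ℂ) * ((∫ v, incr r v : ℝ) : ℂ) := by
  unfold actW
  rw [termsW_X₀, Finset.sum_singleton, Finset.sum_singleton, termBi_coreFam, termBi_coreFam, ← mul_sub,
    ← integral_sub (integrable_term r hr 1) (integrable_term r hr 0), ← integral_complex_ofReal]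
  congr 1
  refine integral_congr_ae (Filter.Eventually.of_forall fun v => ?_)
  simp only [incr, one_mul, zero_mul, Complex.exp_zero]; push_cast; ring
/-- The pencil's activities at `X₀` are SMALL: `‖act s X₀‖ ≤ A·e^{−2r}·e^{‖s‖r}`. [folklore] -/
theorem norm_actW_X₀_le (k : ℕ) (s : ℂ) : ‖actW r hr N k s (X₀ N)‖ ≤ Acst * Real.exp (-(2 * r)) * Real.exp (‖s‖ * r) := by
  unfold actW
  rw [termsW_X₀, Finset.sum_singleton, termBi_coreFam, norm_mul, Complex.norm_real, Real.norm_eq_abs, abs_of_pos (cW_pos r)]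
  have hb : ∀ v : E1, ‖cexp (s * ((r : ℂ) * (Real.exp (-(crd v ^ 2)) : ℂ))) * cexp (-(((‖v‖ ^ 2 : ℝ) : ℂ)))‖ ≤
      Real.exp (‖s‖ * r) * Real.exp (-‖v‖ ^ 2) := fun v => by
    rw [norm_mul, ← Complex.ofReal_neg, Complex.norm_exp_ofReal]
    exact mul_le_mul_of_nonneg_right (norm_cexp_readOut_le r hr s v) (Real.exp_pos _).le
  have hI := norm_integral_le_of_norm_le ((integrable_gauss_E1).const_mul (Real.exp (‖s‖ * r))) (Filter.Eventually.of_forall hb)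
  rw [integral_const_mul, gaussian_E1] at hI
  calc cW r * ‖∫ v : E1, cexp (s * ((r : ℂ) * (Real.exp (-(crd v ^ 2)) : ℂ))) * cexp (-(((‖v‖ ^ 2 : ℝ) : ℂ)))‖
      ≤ cW r * (Real.exp (‖s‖ * r) * Real.sqrt Real.pi) := by gcongr; exact (cW_pos r).le
    _ = Acst * Real.exp (-(2 * r)) * Real.exp (‖s‖ * r) := by
        unfold cW; have := (Real.sqrt_pos.2 Real.pi_pos).ne'; field_simp
include hr in
/-- … hence STRICTLY inside the unit disc for `‖s‖ ≤ 1`, `0 < r` (`A ≤ 1`: W24's `dressedConst_le_one`). [folklore] -/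
theorem norm_actW_X₀_lt_one (hr0 : 0 < r) (k : ℕ) {s : ℂ} (hs : ‖s‖ ≤ 1) : ‖actW r hr N k s (X₀ N)‖ < 1 := by
  refine (norm_actW_X₀_le r hr N k s).trans_lt ?_
  have hA : Acst ≤ 1 := dressedConst_le_one
  have he : Real.exp (-(2 * r)) * Real.exp (‖s‖ * r) < 1 := by rw [← Real.exp_add, Real.exp_lt_one_iff]; nlinarith
  have := Acst_pos; nlinarith
/-- **THE ATTACHED PART OF THE ACTIVITY IS NOT ZERO** (`c > 0`, `∫ g > 0`). [folklore] -/
theorem actW_live (hr0 : 0 < r) (k : ℕ) : actW r hr N k 1 (X₀ N) ≠ actW r hr N k 0 (X₀ N) := by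
  intro h
  have h0 := sub_eq_zero.2 h; rw [actW_one_sub_zero] at h0
  rcases mul_eq_zero.1 h0 with hc | hI
  · exact (cW_pos r).ne' (by exact_mod_cast hc)
  · exact (integral_incr_pos r hr0).ne' (by exact_mod_cast hI)
open Classical in
/-- **THE BOUNDED QUANTITY OF THE END IS NOT ZERO** [decided toy]: the dressed small-field outputs at the sources `1` and `0` DIFFER on the
cube — W24's `exp_locE_cube` (`exp E_w({0}) = 1 + w X₀` for `‖w X₀‖ < 1`) BY NAME turns equal outputs into equal activities at `X₀`. [folklore] -/
theorem coresEnd_live (hr0 : 0 < r) (k : ℕ) :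
    locE (tgeometry 4 N).ι (tgeometry 4 N).cubes (actW r hr N k 1) ((tgeometry 4 N).cubes (X₀ N)) ≠
      locE (tgeometry 4 N).ι (tgeometry 4 N).cubes (actW r hr N k 0) ((tgeometry 4 N).cubes (X₀ N)) := by
  intro h
  have h1 := exp_locE_cube N (w := actW r hr N k 1) (norm_actW_X₀_lt_one r hr N hr0 k (by simp))
  have h0 := exp_locE_cube N (w := actW r hr N k 0) (norm_actW_X₀_lt_one r hr N hr0 k (by simp))
  have h' : cexp (locE (TTouch (d := 4) (N := N)) (fun Z : (tsys 4 N).Dom => Z.1) (actW r hr N k 1) {0}) =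
      cexp (locE (TTouch (d := 4) (N := N)) (fun Z : (tsys 4 N).Dom => Z.1) (actW r hr N k 0) {0}) := congrArg cexp h
  rw [h1, h0, add_right_inj] at h'
  exact actW_live r hr N hr0 k h'
/-- THE CONTOUR LETTER IS NOT IDLE: with radius `r = 0` the read-out is TABLE-BLIND. [folklore] -/
example (c : ℝ) (p : Unit) (v : E1) (h : B13HistM toyFrame) : (coreW c 0 le_rfl).readOut p v h = 0 := by
  rw [readOut_coreW, Complex.ofReal_zero, zero_mul]

end Torus

end Summit.QuantumFields.BalabanUV.T4Continuum.NE1p.DressedSmallFieldCoresWitness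

end
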